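import Mathlib
import Literature.Barriers.MatrixMultiplication.NormalizerBarrier
import Literature.RepresentationTheory.FiniteGroups.CharacterDegrees
import Literature.RepresentationTheory.FiniteGroups.IrreducibleCharacters
import Literature.RepresentationTheory.FiniteGroups.InducedClassFunction
import Literature.RepresentationTheory.FiniteGroups.BrauerInduction
import Summits.MatrixMultiplication.MatrixMultiplication.Theorems.LieRankDesigns.Negative.Basics
import Summits.MatrixMultiplication.MatrixMultiplication.Theorems.SubgroupIdentityDesigns.Negative.BlockSliceTypes
import Summits.MatrixMultiplication.MatrixMultiplication.Theorems.SubgroupIdentityDesigns.Negative.BlockSliceNoGo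
import Summits.MatrixMultiplication.MatrixMultiplication.Theorems.SubgroupIdentityDesigns.Negative.BlockSliceConditional
import Summits.MatrixMultiplication.MatrixMultiplication.Theorems.SubgroupIdentityDesigns.Negative.BlockSliceTranslate
import Summits.MatrixMultiplication.MatrixMultiplication.Theorems.SubgroupIdentityDesigns.Negative.ConstituentLevel
import Summits.MatrixMultiplication.MatrixMultiplication.Theorems.SubgroupIdentityDesigns.Negative.GrassmannCharacter

/-!
# General-`k` block-slice no-go, conditional only on the Grassmannian orbit count

Supports stmt-MatrixMultiplication-14079 (route `LevelGradedCohnUmans`).  VALUE = theorem, NOT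
    summit
progress.  Let `Φ = grassChar 𝔽_p k l = Ind_P^G 1` be the permutation character of
`G = GL_{k+l}(𝔽_p)` on `k`-subspaces (`GrassmannCharacter`: `Φ ∈ F_k`, `Φ(1) ≥ p^{kl}`).

* `exists_irrChar_of_norm` — **BLOCK-SLICES Lemma 2.1 up to the norm**: if `⟨Φ, Φ⟩ ≤ c` then some
  IRREDUCIBLE `ψ ∈ Irr(G) ∩ F_k` has `c · ψ(1) ≥ p^{kl}` (`ConstituentLevel`: the constituents of
  the level-`k` character `Φ` lie in `F_k`, and the largest has degree `≥ Φ(1)/⟨Φ,Φ⟩`).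
* `volume_sq_lt_real` — `V² < p^{3k² + 5kl}` for subgroup-TPP triples with products in a conjugate
  block slice (`BlockSliceNoGo.volume_sq_le_of_hom` + `|GL_k| < p^{k²}`).
* `not_budget_lt_of_norm` / `not_budget_lt_of_norm_translate` — hence, whenever
  `c⁶ · p^{3k²+5kl} ≤ p^{6kl}`, NO subgroup-TPP triple whose products lie in a two-sided translate
  `x S_{k+l,k} y` of the block slice satisfies the crux inequality, for ANY exponent `s > 0`
  (resp. `2 + ε`, `ε > 0`): `budget ≥ ψ(1)^s ≥ (p^{kl}/c)^s > V^{s/3}`.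
* `threshold_of_le` — with the expected value `c = k + 1 = |P\G/P|` (`l ≥ k`) the numeric side
  condition holds as soon as `l ≥ 3k + 6` (all primes `p`), giving `no_translate_witness_of_norm`:
  **the general-`k` no-go for `l ≥ 3k + 6`, all `p`, all `ε > 0`, conditional on the single
  statement `⟨Φ, Φ⟩ ≤ k + 1`** (the number of `P`-orbits on `k`-subspaces, classified by
  `dim (W ∩ W₀) ∈ {0, …, k}`), which replaces the unipotent-character input `χ^{(l,1^k)}` of the
  original Lemma 2.1.
-/

set_option linter.dupNamespace false

noncomputable section

open scoped BigOperators Matrix Classical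
open Literature.Barriers.MatrixMultiplication (SubgroupTPP)
open Literature.RepresentationTheory.FiniteGroups
open Summit.MatrixMultiplication.MatrixMultiplication.Theorems.LieRankDesigns.Negative

namespace Summit.MatrixMultiplication.MatrixMultiplication.Theorems.SubgroupIdentityDesigns.Negative
namespace GrassmannNoGo

open BlockSliceTypes (Dblk)
open BlockSliceNoGo (toSum toSumHom Dblk_toSum volume_sq_le_of_hom card_GL_lt)
open BlockSliceConditional (rpow_le_budget conjToSum conjToSum_injective)
open BlockSliceTranslate (translate_to_conj_fin)
open ConstituentLevel (exists_irrChar_levelSet_degree_ge)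
open GrassmannCharacter (grassChar isCharacter_grassChar grassChar_mem_levelSet grassChar_one_ge
  grassChar_one_ne_zero)

variable {p : ℕ} [hp : Fact p.Prime] {k l : ℕ}


/-- **Lemma 2.1 up to the norm**: `⟨Φ, Φ⟩ ≤ c` gives an irreducible `ψ ∈ Irr ∩ F_k` with
`p^{kl} ≤ c · ψ(1)`. -/
theorem exists_irrChar_of_norm {c : ℝ} (hc : (classInner (grassChar (ZMod p) k l) (grassChar (ZMod
    p) k l)).re ≤ c) :
    ∃ ψ ∈ irrChars (GLm p (k + l)) ∩ levelSet p (k + l) k,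
      ((p ^ (k * l) : ℕ) : ℝ) ≤ c * (ψ 1).re := by
  obtain ⟨ψ, hψ, hdeg⟩ := exists_irrChar_levelSet_degree_ge
    (isCharacter_grassChar (F := ZMod p) (k := k) (l := l)) grassChar_mem_levelSet
    grassChar_one_ne_zero
  exact ⟨ψ, hψ, (grassChar_one_ge.trans hdeg).trans
    (mul_le_mul_of_nonneg_right hc (re_apply_one_nonneg hψ.1))⟩

/-- **`V² < p^{3k²+5kl}`** for a subgroup-TPP triple whose products lie in the conjugate block
slice `x S x⁻¹` (`k ≥ 1`). -/
theorem volume_sq_lt_real (hk : 1 ≤ k) {H₁ H₂ H₃ : Subgroup (GLm p (k + l))}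
    (htpp : SubgroupTPP H₁ H₂ H₃) (x : GLm p (k + l))
    (hS : ∀ a ∈ H₁, ∀ b ∈ H₂, ∀ c ∈ H₃, ∀ i j : Fin l,
      ((x⁻¹ * (a * b * c) * x : GLm p (k + l)) : Mat p (k + l)) (Fin.natAdd k i) (Fin.natAdd k j) =
        (1 : Matrix (Fin l) (Fin l) (ZMod p)) i j) :
    (((Nat.card H₁ * Nat.card H₂ * Nat.card H₃ : ℕ) : ℝ)) ^ 2 <
      (p : ℝ) ^ (3 * (k * k) + 5 * k * l) := by
  have hφ := conjToSum_injective (F := ZMod p) (k := k) (l := l) x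
  have hS' : ∀ a ∈ H₁, ∀ b ∈ H₂, ∀ c ∈ H₃,
      Dblk (conjToSum (F := ZMod p) (k := k) (l := l) x (a * b * c)) = 1 := by
    intro a ha b hb c hc
    ext i j
    show Dblk (toSumHom ((MulAut.conj x⁻¹) (a * b * c))) i j = _
    rw [Dblk_toSum, MulAut.conj_apply, inv_inv]
    exact hS a ha b hb c hc i j
  have h0 := volume_sq_le_of_hom (conjToSum x) hφ htpp hS'
  have hGL := card_GL_lt (F := ZMod p) hk
  rw [Nat.card_zmod] at h0 hGL
  have hp1 : 1 ≤ p := hp.out.one_lt.le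
  have h1 : (Nat.card H₁ * Nat.card H₂ * Nat.card H₃) ^ 2 < p ^ (3 * (k * k) + 5 * k * l) := by
    calc (Nat.card H₁ * Nat.card H₂ * Nat.card H₃) ^ 2
        ≤ Nat.card (GL (Fin k) (ZMod p)) ^ 3 * p ^ (5 * k * l) := h0
      _ < (p ^ (k * k)) ^ 3 * p ^ (5 * k * l) :=
          Nat.mul_lt_mul_of_pos_right (Nat.pow_lt_pow_left hGL (by norm_num)) (Nat.pow_pos hp1)
      _ = p ^ (3 * (k * k) + 5 * k * l) := by rw [← pow_mul, ← pow_add]; ring_nf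
  exact_mod_cast h1

/-- **General-`k` no-go, conditional on the norm.**  `k ≥ 1`; `⟨Φ, Φ⟩ ≤ c` with
`c⁶ p^{3k²+5kl} ≤ p^{6kl}`.  Then for every subgroup-TPP triple of `GL_{k+l}(𝔽_p)` whose products
lie in a conjugate block slice and every `s > 0`: `¬ (budget_k(s) < V^{s/3})`. -/
theorem not_budget_lt_of_norm (hk : 1 ≤ k) {c : ℝ} (hc0 : 0 < c) (hc : (classInner (grassChar (ZMod
    p) k l) (grassChar (ZMod p) k l)).re ≤ c)
    (hthr : c ^ 6 * (p : ℝ) ^ (3 * (k * k) + 5 * k * l) ≤ (p : ℝ) ^ (6 * (k * l)))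
    {H₁ H₂ H₃ : Subgroup (GLm p (k + l))} (htpp : SubgroupTPP H₁ H₂ H₃) (x : GLm p (k + l))
    (hS : ∀ a ∈ H₁, ∀ b ∈ H₂, ∀ c ∈ H₃, ∀ i j : Fin l,
      ((x⁻¹ * (a * b * c) * x : GLm p (k + l)) : Mat p (k + l)) (Fin.natAdd k i) (Fin.natAdd k j) =
        (1 : Matrix (Fin l) (Fin l) (ZMod p)) i j)
    {s : ℝ} (hs : 0 < s) :
    ¬ (budget p (k + l) k s < ((Nat.card H₁ * Nat.card H₂ * Nat.card H₃ : ℕ) : ℝ) ^ (s / 3)) := by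
  intro hlt
  obtain ⟨ψ, hψ, hdeg⟩ := exists_irrChar_of_norm (p := p) (k := k) (l := l) hc
  have hV := volume_sq_lt_real hk htpp x hS
  set V : ℝ := ((Nat.card H₁ * Nat.card H₂ * Nat.card H₃ : ℕ) : ℝ) with hVdef
  have hV0 : 0 ≤ V := Nat.cast_nonneg _
  set u : ℝ := V ^ ((1 : ℝ) / 3) with hu
  have hu0 : 0 ≤ u := Real.rpow_nonneg hV0 _
  have hu6 : u ^ 6 = V ^ 2 := by
    rw [hu, ← Real.rpow_natCast, ← Real.rpow_mul hV0, ← Real.rpow_two]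
    congr 1
    norm_num
  have hP0 : (0 : ℝ) ≤ (p : ℝ) ^ (k * l) := by positivity
  -- `(c u)⁶ = c⁶ V² < c⁶ p^{3k²+5kl} ≤ p^{6kl} = (p^{kl})⁶`
  have h6 : (c * u) ^ 6 < ((p : ℝ) ^ (k * l)) ^ 6 := by
    rw [mul_pow, hu6, ← pow_mul]
    calc c ^ 6 * V ^ 2 < c ^ 6 * (p : ℝ) ^ (3 * (k * k) + 5 * k * l) :=
          mul_lt_mul_of_pos_left hV (pow_pos hc0 6)
      _ ≤ (p : ℝ) ^ (6 * (k * l)) := hthr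
      _ = (p : ℝ) ^ (k * l * 6) := by rw [mul_comm]
  have hcu : c * u < (p : ℝ) ^ (k * l) :=
    not_le.mp fun hge => absurd h6 (not_lt.mpr (pow_le_pow_left₀ hP0 hge 6))
  have hdeg' : (p : ℝ) ^ (k * l) ≤ c * (ψ 1).re := by exact_mod_cast hdeg
  have hu_lt : u < (ψ 1).re := lt_of_mul_lt_mul_left (hcu.trans_le hdeg') hc0.le
  have h1 : V ^ (s / 3) = u ^ s := by
    rw [hu, ← Real.rpow_mul hV0]
    congr 1
    ring
  have h2 : u ^ s < (ψ 1).re ^ s := Real.rpow_lt_rpow hu0 hu_lt hs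
  have h3 : (ψ 1).re ^ s ≤ budget p (k + l) k s := rpow_le_budget hψ s
  rw [h1] at hlt
  linarith

/-- **The same on every two-sided translate `x S y` of the slice, at the crux's exponents.** -/
theorem not_budget_lt_of_norm_translate (hk : 1 ≤ k) {c : ℝ} (hc0 : 0 < c)
    (hc : (classInner (grassChar (ZMod p) k l) (grassChar (ZMod p) k l)).re ≤ c)
    (hthr : c ^ 6 * (p : ℝ) ^ (3 * (k * k) + 5 * k * l) ≤ (p : ℝ) ^ (6 * (k * l)))
    {H₁ H₂ H₃ : Subgroup (GLm p (k + l))} (htpp : SubgroupTPP H₁ H₂ H₃) (x y : GLm p (k + l))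
    (hS : ∀ a ∈ H₁, ∀ b ∈ H₂, ∀ c ∈ H₃, ∀ i j : Fin l,
      ((x⁻¹ * (a * b * c) * y⁻¹ : GLm p (k + l)) : Mat p (k + l)) (Fin.natAdd k i)
          (Fin.natAdd k j) = (1 : Matrix (Fin l) (Fin l) (ZMod p)) i j)
    {ε : ℝ} (hε : 0 < ε) :
    ¬ ((∑ᶠ ψ ∈ irrChars (GLm p (k + l)) ∩ levelSet p (k + l) k, (ψ 1).re ^ (2 + ε)) <
        ((Nat.card H₁ * Nat.card H₂ * Nat.card H₃ : ℕ) : ℝ) ^ ((2 + ε) / 3)) := by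
  have h1 := hS 1 H₁.one_mem 1 H₂.one_mem 1 H₃.one_mem
  simp only [mul_one] at h1
  obtain ⟨z, hz⟩ := translate_to_conj_fin x y h1
  exact not_budget_lt_of_norm hk hc0 hc hthr htpp z
    (fun a ha b hb c hc => hz _ (hS a ha b hb c hc)) (s := 2 + ε) (by linarith)

/-! ## The numeric side condition for `c = k + 1` -/

/-- For `l ≥ 3k + 6` and any prime `p`: `(k+1)⁶ · p^{3k²+5kl} ≤ p^{6kl}`
(`k + 1 ≤ 2^k ≤ p^k` and `3k² + 5kl + 6k ≤ 6kl`). -/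
theorem threshold_of_le (hl : 3 * k + 6 ≤ l) :
    ((k + 1 : ℕ) : ℝ) ^ 6 * (p : ℝ) ^ (3 * (k * k) + 5 * k * l) ≤ (p : ℝ) ^ (6 * (k * l)) := by
  have hp2 : 2 ≤ p := hp.out.two_le
  have h1 : k + 1 ≤ p ^ k :=
    (Nat.succ_le_of_lt Nat.lt_two_pow_self).trans (Nat.pow_le_pow_left hp2 k)
  have h2 : (k + 1) ^ 6 * p ^ (3 * (k * k) + 5 * k * l) ≤ p ^ (6 * (k * l)) := by
    calc (k + 1) ^ 6 * p ^ (3 * (k * k) + 5 * k * l)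
        ≤ (p ^ k) ^ 6 * p ^ (3 * (k * k) + 5 * k * l) :=
          Nat.mul_le_mul_right _ (Nat.pow_le_pow_left h1 6)
      _ = p ^ (6 * k + (3 * (k * k) + 5 * k * l)) := by rw [← pow_mul, ← pow_add, mul_comm k 6]
      _ ≤ p ^ (6 * (k * l)) := by
          apply Nat.pow_le_pow_right (by omega)
          have : k * (3 * k + 6) ≤ k * l := Nat.mul_le_mul_left k hl
          nlinarith
  exact_mod_cast h2

/-- **General-`k` no-go for `l ≥ 3k + 6`, conditional on `⟨Φ, Φ⟩ ≤ k + 1`.**  For every prime `p`,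
every `ε > 0` and every subgroup-TPP triple of `GL_{k+l}(𝔽_p)` whose products lie in a two-sided
translate `x S_{k+l,k} y` of the block slice, the crux inequality
`∑ᶠ_{ψ ∈ Irr ∩ F_k} (ψ 1).re^{2+ε} < (|H₁||H₂||H₃|)^{(2+ε)/3}` FAILS. -/
theorem no_translate_witness_of_norm (hk : 1 ≤ k) (hl : 3 * k + 6 ≤ l)
    (hnorm : (classInner (grassChar (ZMod p) k l) (grassChar (ZMod p) k l)).re ≤ (k + 1 : ℕ))
    {H₁ H₂ H₃ : Subgroup (GLm p (k + l))} (htpp : SubgroupTPP H₁ H₂ H₃) (x y : GLm p (k + l))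
    (hS : ∀ a ∈ H₁, ∀ b ∈ H₂, ∀ c ∈ H₃, ∀ i j : Fin l,
      ((x⁻¹ * (a * b * c) * y⁻¹ : GLm p (k + l)) : Mat p (k + l)) (Fin.natAdd k i)
          (Fin.natAdd k j) = (1 : Matrix (Fin l) (Fin l) (ZMod p)) i j)
    {ε : ℝ} (hε : 0 < ε) :
    ¬ ((∑ᶠ ψ ∈ irrChars (GLm p (k + l)) ∩ levelSet p (k + l) k, (ψ 1).re ^ (2 + ε)) <
        ((Nat.card H₁ * Nat.card H₂ * Nat.card H₃ : ℕ) : ℝ) ^ ((2 + ε) / 3)) :=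
  not_budget_lt_of_norm_translate hk (by positivity) hnorm (threshold_of_le hl) htpp x y hS hε

end GrassmannNoGo
end Summit.MatrixMultiplication.MatrixMultiplication.Theorems.SubgroupIdentityDesigns.Negative
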